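import Mathlib
import Literature.Analysis.FluidPDE.HardSphereCollisionRecord
import Literature.Analysis.FluidPDE.HardSphereTorusMeasure
import Literature.MathematicalPhysics.KineticTheory.HardSphereEuler
import Literature.MathematicalPhysics.KineticTheory.HardSphereEulerProofs
import HarnessLib

/-!
# `OneFlightGossipEngine.OneFlightLayeredChaos` — brick B2: uniform one-particle marginal of a translation-invariant event
(crux stmt-AtomisticToContinuum-14535, line `Sketch`, first-rung reduction; registered stub
`measure_inter_eval_mem_eq_volume_mul`).

Let `μ` be a finite measure on the configuration space `(𝕋³)ⁿ = Fin n → T3` which is invariant under the GLOBAL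
translation `T_a : x ↦ (k ↦ x k + a)` of all positions by the same `a ∈ 𝕋³`, and let `F ⊆ (𝕋³)ⁿ` be a measurable
event with `T_a ⁻¹' F = F` for every `a`.  Then, conditionally on `F`, the position of any single particle `i` is
UNIFORM on the torus:
`μ (F ∩ {x | x i ∈ B}) = vol(B) · μ F` for every measurable `B ⊆ 𝕋³`
(`volume` on `T3 = UnitAddTorus (Fin 3)` is the Haar probability measure).  In the first rung of the crux this
gives the exact `ε/r` price of the thin cell layer of the tagged particle.

Proof (Fubini on the joint event).  Put `S := {(x, a) ∈ (𝕋³)ⁿ × 𝕋³ | x ∈ F, x i + a ∈ B}` and compute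
`(μ ⊗ vol) S` in the two orders:
* `a`-sections: `{x | (x, a) ∈ S} = T_a ⁻¹' (F ∩ {x | x i ∈ B})` (by `T_a ⁻¹' F = F`), whose `μ`-measure is
  `μ (F ∩ {x | x i ∈ B})` by `(T_a)_# μ = μ`; integrating the constant over the probability space `𝕋³` gives
  `(μ ⊗ vol) S = μ (F ∩ {x | x i ∈ B})`;
* `x`-sections: for `x ∈ F` the section is the translate `{a | x i + a ∈ B}`, of Haar measure `vol B`
  (`measure_preimage_add`), and it is empty for `x ∉ F`; hence `(μ ⊗ vol) S = vol(B) · μ F`.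

References: H. Spohn, *Large Scale Dynamics of Interacting Particles* (1991), Part I §2.3 (homogeneous states:
translation invariance and uniform one-point marginals) [Spohn1991].
-/

open scoped ENNReal
open MeasureTheory Set
open Literature.MathematicalPhysics.KineticTheory

namespace Summit.AtomisticToContinuum.HydrodynamicLimit.Theorems.OLC

/-- **Brick B2 (registered stub `measure_inter_eval_mem_eq_volume_mul`).** For a finite measure `μ` on `(𝕋³)ⁿ`
invariant under the global translations `x ↦ (k ↦ x k + a)` and a measurable event `F` invariant under the same
translations, the position of any one particle is uniform on `𝕋³` conditionally on `F`:
`μ (F ∩ {x | x i ∈ B}) = vol(B) · μ F` for every measurable `B ⊆ 𝕋³`. [folklore] -/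
theorem measure_inter_eval_mem_eq_volume_mul : ∀ {n : ℕ} (μ : MeasureTheory.Measure (Fin n → Literature.MathematicalPhysics.KineticTheory.T3)) [MeasureTheory.IsFiniteMeasure μ], (∀ a : Literature.MathematicalPhysics.KineticTheory.T3, MeasureTheory.Measure.map (fun x : Fin n → Literature.MathematicalPhysics.KineticTheory.T3 => fun k => x k + a) μ = μ) → ∀ {F : Set (Fin n → Literature.MathematicalPhysics.KineticTheory.T3)}, MeasurableSet F → (∀ a : Literature.MathematicalPhysics.KineticTheory.T3, (fun x : Fin n → Literature.MathematicalPhysics.KineticTheory.T3 => fun k => x k + a) ⁻¹' F = F) → ∀ (i : Fin n) {B : Set Literature.MathematicalPhysics.KineticTheory.T3}, MeasurableSet B → μ (F ∩ {x | x i ∈ B}) = MeasureTheory.volume B * μ F := by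
  intro n μ _ hμ F hF hFinv i B hB
  -- the joint event `S = {(x, a) | x ∈ F, x i + a ∈ B}` in `(𝕋³)ⁿ × 𝕋³`
  set S : Set ((Fin n → T3) × T3) := {p | p.1 ∈ F ∧ p.1 i + p.2 ∈ B} with hS_def
  have hSm : MeasurableSet S := by
    have h1 : Measurable fun p : (Fin n → T3) × T3 => p.1 i + p.2 :=
      ((measurable_pi_apply i).comp measurable_fst).add measurable_snd
    exact (measurable_fst hF).inter (h1 hB)
  have hT : ∀ a : T3, Measurable (fun x : Fin n → T3 => fun k => x k + a) := fun a =>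
    measurable_pi_iff.mpr fun k => (measurable_pi_apply k).add measurable_const
  have hEm : MeasurableSet (F ∩ {x : Fin n → T3 | x i ∈ B}) := hF.inter (measurable_pi_apply i hB)
  -- `a`-sections: translates of `F ∩ {x | x i ∈ B}`, all of the same `μ`-measure
  have key1 : ∀ a : T3, μ ((fun x : Fin n → T3 => (x, a)) ⁻¹' S) = μ (F ∩ {x | x i ∈ B}) := by
    intro a
    have hpre : (fun x : Fin n → T3 => (x, a)) ⁻¹' S =
        (fun x : Fin n → T3 => fun k => x k + a) ⁻¹' (F ∩ {x | x i ∈ B}) := by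
      rw [preimage_inter, hFinv a]
      rfl
    rw [hpre, ← Measure.map_apply (hT a) hEm, hμ a]
  -- `x`-sections: a translate of `B` (Haar measure `vol B`) if `x ∈ F`, empty otherwise
  have key2 : ∀ x : Fin n → T3, volume (Prod.mk x ⁻¹' S) = F.indicator (fun _ => volume B) x := by
    intro x
    by_cases hx : x ∈ F
    · rw [indicator_of_mem hx]
      have hsec : Prod.mk x ⁻¹' S = (fun a : T3 => x i + a) ⁻¹' B := by
        ext a
        simp [hS_def, hx]
      rw [hsec, measure_preimage_add]
    · rw [indicator_of_notMem hx]
      have hsec : Prod.mk x ⁻¹' S = ∅ := by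
        ext a
        simp [hS_def, hx]
      rw [hsec, measure_empty]
  have h1 : (μ.prod volume) S = volume B * μ F := by
    rw [Measure.prod_apply hSm]
    simp_rw [key2]
    rw [lintegral_indicator_const hF]
  have h2 : (μ.prod volume) S = μ (F ∩ {x | x i ∈ B}) := by
    rw [Measure.prod_apply_symm hSm]
    simp_rw [key1]
    rw [lintegral_const, measure_univ, mul_one]
  rw [← h2, h1]

end Summit.AtomisticToContinuum.HydrodynamicLimit.Theorems.OLC
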